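import Literature.Geometry.Lorentzian.InverseMeanCurvatureFlowCompactness
import HarnessLib

/-!
# Inverse mean curvature flow I — proofs: the Compactness Theorem for approximate solutions

`InverseMeanCurvatureFlowCompactness.lean` proves Huisken–Ilmanen's Compactness Theorem 2.1
(J. Differential Geom. 59 (2001), §2): locally uniform limits of weak solutions with local Lipschitz
bounds are weak solutions. For the passage `ε → 0` in the elliptic regularisation of Thm. 3.1 one
needs the same conclusion when the `uᵢ` are only *approximately* minimising,

  `J_{uᵢ}^K(uᵢ) ≤ J_{uᵢ}^K(w) + δᵢ (μ_h(K) + ∫_K |w − uᵢ| dμ_h)`,  `δᵢ → 0`,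

which is exactly what classical solutions `uᵢ = u^{εᵢ}` of (⋆)_{εᵢ} satisfy with `δᵢ = εᵢ`
(`imcfEnergy_le_add_of_regularised`, `InverseMeanCurvatureFlowRegularised.lean`). This file proves
that version (`isWeakSolution_of_tendstoLocallyUniformlyOn_of_approx`): the proof of Thm. 2.1 goes
through verbatim, the cutoff inequality acquiring the error `δᵢ (μ(S) + ∫_S |v − uᵢ|)`
(`setIntegral_cutoff_le_of_approx`), which tends to `0` because `uᵢ → u` uniformly on the compact
`S` (`imcfEnergy_le_of_tendsto_of_approx_of_le_add_one`); step 2 is unchanged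
(`isWeakSolution_of_forall_le_add_one`). Huisken–Ilmanen obtain the same effect through the exact
solutions `uᵢ(x) − εᵢ z` of the flow on `M × ℝ` (Lemma 2.3) and Remark 2 after Thm. 2.1.

Everything is proved; there are no definitions and no named facts.

## References

* G. Huisken, T. Ilmanen, *The inverse mean curvature flow and the Riemannian Penrose
  inequality*, J. Differential Geom. 59 (2001) 353–437: §2, Thm. 2.1 and its proof (p. 21–22),
  Remark 2; §3, proof of Thm. 3.1 (p. 26–27).
-/

noncomputable section

open Bundle Set Manifold TopologicalSpace Filter MeasureTheory Function
open scoped ContDiff Topology ENNReal NNReal Manifold Real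

namespace Literature.Geometry.Lorentzian

open PseudoRiemannianMetric

variable {X : Type*} [TopologicalSpace X] [ChartedSpace E3 X] [IsManifold (𝓡 3) ∞ X]
  (h : ContMDiffRiemannianMetric (𝓡 3) ∞ E3 (TangentSpace (𝓡 3) : X → Type _))
  [T2Space X] [LocallyCompactSpace X] [MeasurableSpace X] [BorelSpace X]
  [SecondCountableTopology X]

/-! ### The cutoff inequality with error -/

set_option backward.isDefEq.respectTransparency false in
/-- **The cutoff inequality for approximate weak solutions** (Huisken–Ilmanen, proof of
Thm. 2.1, step 1, p. 21–22, with an additive error). Let `u` be locally Lipschitz on the open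
set `Ω` and `δ`-approximately minimising there (`J_u^K(u) ≤ J_u^K(w) + δ (μ(K) + ∫_K |w − u|)` for
all competitors `w`, the property of classical solutions of the elliptic regularisation,
`imcfEnergy_le_add_of_regularised`), `v` locally Lipschitz on the open set `Ω'`, `S` a
compact subset of `Ω ∩ Ω'`, and `φ ∈ C¹` a cutoff with `0 ≤ φ ≤ 1` and `tsupport φ ⊆ S`. Then
`vᵢ = φ v + (1 − φ) u` "is a valid comparison function for `u`", and inserting it into (1.5) gives
`∫_S φ (1 + u − v) |∇u| ≤ ∫_S φ |∇v| + ∫_S |v − u| |∇φ| + δ (μ(S) + ∫_S |v − u|)`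
(from `|∇vᵢ| ≤ φ|∇v| + (1 − φ)|∇u| + |v − u||∇φ|` a.e., `gradNorm_cutoff_combination_le`).
[cite: HuiskenIlmanenIMCF2001, §2 proof of Thm. 2.1 (step 1)] -/
theorem setIntegral_cutoff_le_of_approx {u v φ : X → ℝ} {Ω Ω' S : Set X} (hΩ : IsOpen Ω)
    (hΩ' : IsOpen Ω') (hul : IsLocLipschitzOn h u Ω) {δ : ℝ} (hδ : 0 ≤ δ)
    (happrox : ∀ w, IsCompetitor h u Ω w → ∀ K, IsCompact K → K ⊆ Ω →
      {x | x ∈ Ω ∧ w x ≠ u x} ⊆ K → imcfEnergy h u K u ≤ imcfEnergy h u K w +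
        δ * ((riemannianMeasure h).real K + ∫ x in K, |w x - u x| ∂riemannianMeasure h))
    (hv : IsLocLipschitzOn h v Ω')
    (hS : IsCompact S) (hSΩ : S ⊆ Ω) (hSΩ' : S ⊆ Ω') (hφ : ContMDiff (𝓡 3) 𝓘(ℝ, ℝ) 1 φ)
    (hφ01 : ∀ x, φ x ∈ Icc (0 : ℝ) 1) (hφS : tsupport φ ⊆ S) :
    ∫ x in S, φ x * (1 + u x - v x) * gradNorm h u x ∂riemannianMeasure h ≤
      (∫ x in S, φ x * gradNorm h v x ∂riemannianMeasure h) +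
        (∫ x in S, |v x - u x| * gradNorm h φ x ∂riemannianMeasure h) +
        δ * ((riemannianMeasure h).real S + ∫ x in S, |v x - u x| ∂riemannianMeasure h) := by
  haveI : IsFiniteMeasureOnCompacts (riemannianMeasure h) :=
    ⟨fun K hK ↦ riemannianVolume_lt_top_of_isCompact_holds h le_rfl hK⟩
  set μ := riemannianMeasure h with hμ
  -- the open set `O = Ω ∩ Ω' ⊇ S` on which everything is locally Lipschitz
  set O := Ω ∩ Ω' with hO
  have hOo : IsOpen O := hΩ.inter hΩ'
  have hSO : S ⊆ O := fun x hx ↦ ⟨hSΩ hx, hSΩ' hx⟩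
  have huO : IsLocLipschitzOn h u O := hul.mono h inter_subset_left
  have hvO : IsLocLipschitzOn h v O := hv.mono h inter_subset_right
  have hφO : IsLocLipschitzOn h φ O := isLocLipschitzOn_of_contMDiff' h hφ O
  -- the competitor `w = φ v + (1 - φ) u`
  set w : X → ℝ := fun x ↦ φ x * v x + (1 - φ x) * u x with hw
  have hwO : IsLocLipschitzOn h w O :=
    (hφO.mul h hvO).add h (((isLocLipschitzOn_const h 1 O).sub h hφO).mul h huO)
  have hφ0' : ∀ x, x ∉ tsupport φ → w x = u x := fun x hx ↦ by
    have hφx : φ x = 0 := image_eq_zero_of_notMem_tsupport hx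
    simp [hw, hφx]
  have hwlip : IsLocLipschitzOn h w Ω :=
    isLocLipschitzOn_of_eqOn_of_eqOn h hOo (isClosed_tsupport φ) (hφS.trans hSO) hul hwO
      (fun x _ ↦ rfl) (fun x hx ↦ hφ0' x hx.2)
  have hexc : {x | x ∈ Ω ∧ w x ≠ u x} ⊆ S := by
    intro x hx
    by_contra hxS
    exact hx.2 (hφ0' x fun h' ↦ hxS (hφS h'))
  have hcomp : IsCompetitor h u Ω w := ⟨hwlip, S, hS, hSΩ, hexc⟩
  have hJ := happrox w hcomp S hS hSΩ hexc
  -- `0 ≤ J_u^S(w) - J_u^S(u)` as one integral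
  have hIu := integrableOn_imcfEnergy_integrand h huO huO hOo hS hSO
  have hIw := integrableOn_imcfEnergy_integrand h huO hwO hOo hS hSO
  -- the error term: `∫_S |w - u| ≤ ∫_S |v - u|` (`|w - u| = φ |v - u|`, `0 ≤ φ ≤ 1`)
  have hcu' : ContinuousOn u S := (huO.continuousOn h).mono hSO
  have hcv' : ContinuousOn v S := (hvO.continuousOn h).mono hSO
  have hcw' : ContinuousOn w S := (hwO.continuousOn h).mono hSO
  have herr : ∫ x in S, |w x - u x| ∂μ ≤ ∫ x in S, |v x - u x| ∂μ := by
    refine setIntegral_mono_on ((hcw'.sub hcu').abs.integrableOn_compact hS)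
      ((hcv'.sub hcu').abs.integrableOn_compact hS) hS.measurableSet fun x _ ↦ ?_
    have hwx : w x - u x = φ x * (v x - u x) := by simp only [hw]; ring
    rw [hwx, abs_mul, abs_of_nonneg (hφ01 x).1]
    calc φ x * |v x - u x| ≤ 1 * |v x - u x| :=
          mul_le_mul_of_nonneg_right (hφ01 x).2 (abs_nonneg _)
      _ = |v x - u x| := one_mul _
  have hJ' : 0 ≤ (∫ x in S, ((gradNorm h w x + w x * gradNorm h u x) -
      (gradNorm h u x + u x * gradNorm h u x)) ∂μ) +
      δ * (μ.real S + ∫ x in S, |v x - u x| ∂μ) := by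
    rw [integral_sub hIw hIu]
    unfold imcfEnergy at hJ
    have hmono : δ * (μ.real S + ∫ x in S, |w x - u x| ∂μ) ≤
        δ * (μ.real S + ∫ x in S, |v x - u x| ∂μ) :=
      mul_le_mul_of_nonneg_left (by linarith) hδ
    linarith
  -- the a.e. pointwise bound from the chain rule
  have hae : ∀ᵐ x ∂μ, x ∈ S →
      (gradNorm h w x + w x * gradNorm h u x) - (gradNorm h u x + u x * gradNorm h u x) ≤
        φ x * gradNorm h v x + |v x - u x| * gradNorm h φ x -
          φ x * (1 + u x - v x) * gradNorm h u x := by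
    filter_upwards [huO.ae_mdifferentiableAt h hOo, hvO.ae_mdifferentiableAt h hOo]
      with x hux hvx hxS
    have hxO := hSO hxS
    have hφd : MDifferentiableAt (𝓡 3) 𝓘(ℝ, ℝ) φ x := hφ.mdifferentiableAt one_ne_zero
    have hslope := gradNorm_cutoff_combination_le h hφd (hφ01 x).1 (hφ01 x).2 (hvx hxO) (hux hxO)
    have hwx : w x = φ x * v x + (1 - φ x) * u x := rfl
    have hww : gradNorm h w x = gradNorm h (fun y ↦ φ y * v y + (1 - φ y) * u y) x := rfl
    rw [hwx, hww]
    nlinarith [hslope, gradNorm_nonneg h u x, (hφ01 x).1]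
  -- integrate
  have hcu : ContinuousOn u S := (huO.continuousOn h).mono hSO
  have hcv : ContinuousOn v S := (hvO.continuousOn h).mono hSO
  have hcφ : ContinuousOn φ S := hφ.continuous.continuousOn
  have hIa : IntegrableOn (fun x ↦ φ x * gradNorm h v x) S μ :=
    hvO.integrableOn_mul_gradNorm h hOo hS hSO hcφ
  have hIb : IntegrableOn (fun x ↦ |v x - u x| * gradNorm h φ x) S μ :=
    hφO.integrableOn_mul_gradNorm h hOo hS hSO (hcv.sub hcu).abs
  have hIc : IntegrableOn (fun x ↦ φ x * (1 + u x - v x) * gradNorm h u x) S μ :=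
    huO.integrableOn_mul_gradNorm h hOo hS hSO (hcφ.mul ((continuousOn_const.add hcu).sub hcv))
  have hIab : IntegrableOn (fun x ↦ φ x * gradNorm h v x + |v x - u x| * gradNorm h φ x) S μ :=
    hIa.add hIb
  have hIabc : IntegrableOn (fun x ↦ φ x * gradNorm h v x + |v x - u x| * gradNorm h φ x -
      φ x * (1 + u x - v x) * gradNorm h u x) S μ := hIab.sub hIc
  have hmono : ∫ x in S, ((gradNorm h w x + w x * gradNorm h u x) -
      (gradNorm h u x + u x * gradNorm h u x)) ∂μ ≤
      ∫ x in S, (φ x * gradNorm h v x + |v x - u x| * gradNorm h φ x -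
        φ x * (1 + u x - v x) * gradNorm h u x) ∂μ :=
    integral_mono_ae (hIw.sub hIu) hIabc ((ae_restrict_iff' hS.measurableSet).2 hae)
  have hsplit : ∫ x in S, (φ x * gradNorm h v x + |v x - u x| * gradNorm h φ x -
        φ x * (1 + u x - v x) * gradNorm h u x) ∂μ =
      (∫ x in S, φ x * gradNorm h v x ∂μ) + (∫ x in S, |v x - u x| * gradNorm h φ x ∂μ) -
        ∫ x in S, φ x * (1 + u x - v x) * gradNorm h u x ∂μ := by
    rw [integral_sub hIab hIc, integral_add hIa hIb]
  rw [hsplit] at hmono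
  linarith


/-! ### Step 1 for approximate solutions -/

set_option backward.isDefEq.respectTransparency false in
/-- **Step 1 of the proof of the Compactness Theorem, for approximate solutions** (Huisken–Ilmanen
2001, p. 21–22): under the hypotheses of Thm. 2.1 with the `uᵢ` only `δᵢ`-approximately minimising,
`δᵢ → 0`, the limit `U` satisfies `J_U^K(U) ≤ J_U^K(v)` for every competitor `v`
with `v ≤ U + 1`. With a cutoff `φ = 1` near `{v ≠ U}` supported in a compact `S ⊆ Ω`, the cutoff
inequality for `uᵢ` (`IsWeakSolution.setIntegral_cutoff_le`) reads
`∫_S φ(1 + uᵢ − v)|∇uᵢ| ≤ ∫_S φ|∇v| + ∫_S |v − uᵢ||∇φ|`; the last term tends to `0`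
(`∇φ = 0` where `v ≠ U`, `uᵢ → U` uniformly on `S`), `∫_S φ|uᵢ − U||∇uᵢ| → 0` by the uniform
gradient bound, and the lower semicontinuity of `∫ φ(1 + U − v)|∇·|`
(`integral_mul_gradNorm_le_of_tendstoLocallyUniformlyOn`) gives `∫_S φ(1 + U − v)|∇U| ≤ ∫_S φ|∇v|`,
which localises to `J_U^K(U) ≤ J_U^K(v)` (`imcfEnergy_le_of_setIntegral_cutoff_le`).
[cite: HuiskenIlmanenIMCF2001, §2 proof of Thm. 2.1 (step 1)] -/
theorem imcfEnergy_le_of_tendsto_of_approx_of_le_add_one {u : ℕ → X → ℝ} {U : X → ℝ}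
    {Ωs : ℕ → Set X} {Ω : Set X} {δ : ℕ → ℝ} (hΩ : IsOpen Ω) (hΩo : ∀ i, IsOpen (Ωs i))
    (hul : ∀ i, IsLocLipschitzOn h (u i) (Ωs i)) (hδ0 : ∀ i, 0 ≤ δ i)
    (hδ : Tendsto δ atTop (𝓝 0))
    (happrox : ∀ i, ∀ w, IsCompetitor h (u i) (Ωs i) w → ∀ K, IsCompact K → K ⊆ Ωs i →
      {x | x ∈ Ωs i ∧ w x ≠ u i x} ⊆ K → imcfEnergy h (u i) K (u i) ≤ imcfEnergy h (u i) K w +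
        δ i * ((riemannianMeasure h).real K + ∫ x in K, |w x - u i x| ∂riemannianMeasure h))
    (hnest : ∀ K, IsCompact K → K ⊆ Ω → ∀ᶠ i in atTop, K ⊆ Ωs i)
    (hconv : TendstoLocallyUniformlyOn u U atTop Ω)
    (hlip : letI : RiemannianBundle (fun x : X ↦ TangentSpace (𝓡 3) x) :=
        ⟨h.toContinuousRiemannianMetric.toRiemannianMetric⟩
      letI : PseudoEMetricSpace X := .ofRiemannianMetric (𝓡 3) X
      ∀ x ∈ Ω, ∃ K : ℝ≥0, ∃ V ∈ 𝓝 x,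
        (∀ᶠ i in atTop, LipschitzOnWith K (u i) V) ∧ LipschitzOnWith K U V)
    (hU : IsLocLipschitzOn h U Ω) {v : X → ℝ} (hv : IsCompetitor h U Ω v)
    (hv1 : ∀ x ∈ Ω, v x ≤ U x + 1) {K : Set X} (hK : IsCompact K) (hKΩ : K ⊆ Ω)
    (hvK : {x | x ∈ Ω ∧ v x ≠ U x} ⊆ K) :
    imcfEnergy h U K U ≤ imcfEnergy h U K v := by
  letI : RiemannianBundle (fun x : X ↦ TangentSpace (𝓡 3) x) :=
    ⟨h.toContinuousRiemannianMetric.toRiemannianMetric⟩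
  letI : PseudoEMetricSpace X := .ofRiemannianMetric (𝓡 3) X
  haveI : IsFiniteMeasureOnCompacts (riemannianMeasure h) :=
    ⟨fun K hK ↦ riemannianVolume_lt_top_of_isCompact_holds h le_rfl hK⟩
  set μ := riemannianMeasure h with hμ
  obtain ⟨hvlip, C, hC, hCΩ, hvC⟩ := hv
  -- nested relatively compact opens `C ⊆ W₁ ⊆ closure W₁ ⊆ W₂ ⊆ S := closure W₂ ⊆ Ω`
  obtain ⟨W₁, hW₁o, hCW₁, hW₁Ω, hW₁c⟩ := exists_open_between_and_isCompact_closure hC hΩ hCΩ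
  obtain ⟨W₂, hW₂o, hW₁W₂, hW₂Ω, hW₂c⟩ := exists_open_between_and_isCompact_closure hW₁c hΩ hW₁Ω
  -- a smooth cutoff `φ = 1` on `closure W₁`, `φ = 0` off `W₂`
  obtain ⟨φ, hφ0, hφ1, hφ01⟩ := exists_contMDiffMap_zero_one_of_isClosed (I := 𝓡 3)
    (n := (⊤ : ℕ∞)) hW₂o.isClosed_compl isClosed_closure (disjoint_compl_left_iff.2 hW₁W₂)
  have hφs : ContMDiff (𝓡 3) 𝓘(ℝ, ℝ) 1 φ := φ.contMDiff.of_le (by exact_mod_cast le_top)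
  have hφcont : Continuous (φ : X → ℝ) := φ.contMDiff.continuous
  have hφsupp : tsupport (φ : X → ℝ) ⊆ closure W₂ :=
    closure_mono fun x hx ↦ by_contra fun hxW ↦ hx (hφ0 hxW)
  have hφcs : HasCompactSupport (φ : X → ℝ) :=
    HasCompactSupport.of_support_subset_isCompact hW₂c ((subset_tsupport _).trans hφsupp)
  have hgradφ : ∀ x ∈ W₁, gradNorm h φ x = 0 := by
    intro x hx
    have hev : (φ : X → ℝ) =ᶠ[𝓝 x] fun _ ↦ (1 : ℝ) := by
      filter_upwards [hW₁o.mem_nhds hx] with y hy using hφ1 (subset_closure hy)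
    rw [gradNorm_congr_of_eventuallyEq h hev, gradNorm_const]
  -- Lipschitz data, a finite subcover of `closure W₂`, a common index `N₀`
  choose! Kx Vx hVx hKu hKU using hlip
  obtain ⟨t, htS, hScov⟩ := hW₂c.elim_nhds_subcover (fun x ↦ interior (Vx x))
    (fun x hx ↦ interior_mem_nhds.2 (hVx x (hW₂Ω hx)))
  have hev : ∀ᶠ i in atTop, closure W₂ ⊆ Ωs i ∧ ∀ x ∈ t, LipschitzOnWith (Kx x) (u i) (Vx x) :=
    (hnest _ hW₂c hW₂Ω).and ((Finset.eventually_all t).2 fun x hx ↦ hKu x (hW₂Ω (htS x hx)))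
  obtain ⟨N₀, hN₀⟩ := eventually_atTop.1 hev
  -- the modified sequence `ũ i = u i` for `i ≥ N₀`, `= U` before
  set ũ : ℕ → X → ℝ := fun i ↦ if N₀ ≤ i then u i else U with hũ
  have hũeq : ∀ i, N₀ ≤ i → ũ i = u i := fun i hi ↦ by simp [hũ, hi]
  have hũU : ∀ i, ¬ N₀ ≤ i → ũ i = U := fun i hi ↦ by simp [hũ, hi]
  have hLip : ∀ i, ∀ x ∈ t, LipschitzOnWith (Kx x) (ũ i) (interior (Vx x)) := by
    intro i x hxt
    by_cases hi : N₀ ≤ i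
    · rw [hũeq i hi]; exact ((hN₀ i hi).2 x hxt).mono interior_subset
    · rw [hũU i hi]; exact (hKU x (hW₂Ω (htS x hxt))).mono interior_subset
  -- the open set `O₃ ⊇ closure W₂` on which the `ũ i` are equi-Lipschitz near every point
  set O₃ := (⋃ x ∈ t, interior (Vx x)) ∩ Ω with hO₃
  have hO₃o : IsOpen O₃ := (isOpen_biUnion fun x _ ↦ isOpen_interior).inter hΩ
  have hSO₃ : closure W₂ ⊆ O₃ := fun y hy ↦ ⟨hScov hy, hW₂Ω hy⟩
  have hlipO₃ : ∀ y ∈ O₃, ∃ K' : ℝ≥0, ∃ V' ∈ 𝓝 y,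
      (∀ i, LipschitzOnWith K' (ũ i) V') ∧ LipschitzOnWith K' U V' := by
    rintro y ⟨hy, -⟩
    obtain ⟨x, hxt, hyx⟩ := mem_iUnion₂.1 hy
    exact ⟨Kx x, interior (Vx x), isOpen_interior.mem_nhds hyx, fun i ↦ hLip i x hxt,
      (hKU x (hW₂Ω (htS x hxt))).mono interior_subset⟩
  have hconvO₃ : TendstoLocallyUniformlyOn ũ U atTop O₃ := by
    refine (hconv.mono inter_subset_right).congr_inseparable ?_
    filter_upwards [eventually_ge_atTop N₀] with i hi y _
    rw [hũeq i hi]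
  -- a uniform gradient bound on `closure W₂`
  set Cg : ℝ := ∑ x ∈ t, (Kx x : ℝ) with hCg
  have hCg0 : 0 ≤ Cg := Finset.sum_nonneg fun x _ ↦ NNReal.coe_nonneg _
  have hgrad : ∀ i, ∀ y ∈ closure W₂, gradNorm h (ũ i) y ≤ Cg := by
    intro i y hy
    obtain ⟨x, hxt, hyx⟩ := mem_iUnion₂.1 (hScov hy)
    have h1 : gradNorm h (ũ i) y ≤ Kx x :=
      gradNorm_le_of_lipschitzOnWith h (isOpen_interior.mem_nhds hyx) (hLip i x hxt)
    exact h1.trans (Finset.single_le_sum (fun z _ ↦ NNReal.coe_nonneg (Kx z)) hxt)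
  -- uniform convergence on `closure W₂`
  have hunif : TendstoUniformlyOn u U atTop (closure W₂) :=
    (tendstoLocallyUniformlyOn_iff_forall_isCompact hΩ).1 hconv _ hW₂Ω hW₂c
  -- the weight `w = φ (1 + U - v) ≥ 0`, continuous with compact support in `closure W₂`
  set w : X → ℝ := fun x ↦ φ x * (1 + U x - v x) with hw
  have hwφ : ∀ x, x ∉ tsupport (φ : X → ℝ) → w x = 0 := fun x hx ↦ by
    simp [hw, image_eq_zero_of_notMem_tsupport hx]
  have hwsupp : tsupport w ⊆ tsupport (φ : X → ℝ) :=
    tsupport_mul_subset_left (f := (φ : X → ℝ)) (g := fun x ↦ 1 + U x - v x)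
  have hwc : HasCompactSupport w := hφcs.mul_right
  have hw0 : ∀ x, 0 ≤ w x := by
    intro x
    by_cases hx : x ∈ Ω
    · exact mul_nonneg (hφ01 x).1 (by linarith [hv1 x hx])
    · rw [hwφ x fun h' ↦ hx (hW₂Ω (hφsupp h'))]
  have hwcont : Continuous w := by
    rw [continuous_iff_continuousAt]
    intro x
    by_cases hx : x ∈ Ω
    · exact hφcont.continuousAt.mul ((continuousAt_const.add
        ((hU.continuousOn h).continuousAt (hΩ.mem_nhds hx))).sub
        ((hvlip.continuousOn h).continuousAt (hΩ.mem_nhds hx)))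
    · have hx' : x ∉ tsupport (φ : X → ℝ) := fun h' ↦ hx (hW₂Ω (hφsupp h'))
      have hev : (fun _ ↦ (0 : ℝ)) =ᶠ[𝓝 x] w := by
        filter_upwards [(isClosed_tsupport (φ : X → ℝ)).isOpen_compl.mem_nhds hx'] with y hy
        exact (hwφ y hy).symm
      exact continuousAt_const.congr hev
  -- the lower semicontinuity of `∫ w |∇·|` along `ũ i → U`
  have hlsc : ∀ {ε : ℝ}, 0 < ε → ∀ᶠ i in atTop, ∫ x, w x * gradNorm h U x ∂μ ≤
      (∫ x, w x * gradNorm h (ũ i) x ∂μ) + ε := fun hε ↦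
    integral_mul_gradNorm_le_of_tendstoLocallyUniformlyOn h hO₃o hconvO₃ hlipO₃ hwcont hw0 hwc
      (hwsupp.trans (hφsupp.trans hSO₃)) hε
  -- the cutoff inequality for `u i`, `i ≥ N₀`
  have hC1 : ∀ i, N₀ ≤ i →
      ∫ x in closure W₂, φ x * (1 + u i x - v x) * gradNorm h (u i) x ∂μ ≤
        (∫ x in closure W₂, φ x * gradNorm h v x ∂μ) +
          (∫ x in closure W₂, |v x - u i x| * gradNorm h φ x ∂μ) +
          δ i * (μ.real (closure W₂) + ∫ x in closure W₂, |v x - u i x| ∂μ) := fun i hi ↦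
    setIntegral_cutoff_le_of_approx h (hΩo i) hΩ (hul i) (hδ0 i) (happrox i) hvlip hW₂c
      (hN₀ i hi).1 hW₂Ω hφs hφ01 hφsupp
  -- whole-space vs. set integrals of `w`-weighted slopes
  have hset : ∀ f : X → ℝ, ∫ x, w x * gradNorm h f x ∂μ =
      ∫ x in closure W₂, w x * gradNorm h f x ∂μ := fun f ↦
    (setIntegral_eq_integral_of_forall_compl_eq_zero fun x hx ↦ by
      rw [hwφ x (fun h' ↦ hx (hφsupp h')), zero_mul]).symm
  -- the passage to the limit: `∫_S w |∇U| ≤ ∫_S φ |∇v|`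
  have hC5 : ∫ x in closure W₂, w x * gradNorm h U x ∂μ ≤
      ∫ x in closure W₂, φ x * gradNorm h v x ∂μ := by
    refine le_of_forall_pos_le_add fun ε hε ↦ ?_
    have hIφ : IntegrableOn (gradNorm h φ) (closure W₂) μ :=
      (isLocLipschitzOn_of_contMDiff h hφs).integrableOn_gradNorm h isOpen_univ hW₂c (subset_univ _)
    have hint0 : 0 ≤ ∫ x in closure W₂, gradNorm h φ x ∂μ :=
      setIntegral_nonneg isClosed_closure.measurableSet fun x _ ↦ gradNorm_nonneg h φ x
    -- a bound for `μ(S) + ∫_S |v - u i|`, uniformly for large `i`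
    set BS : ℝ := μ.real (closure W₂) + ((∫ x in closure W₂, |v x - U x| ∂μ) + μ.real (closure W₂))
      with hBS
    have hBS0 : 0 ≤ BS := by
      have : 0 ≤ ∫ x in closure W₂, |v x - U x| ∂μ :=
        setIntegral_nonneg isClosed_closure.measurableSet fun x _ ↦ abs_nonneg _
      have : 0 ≤ μ.real (closure W₂) := measureReal_nonneg
      linarith
    set M : ℝ := (∫ x in closure W₂, gradNorm h φ x ∂μ) + Cg * μ.real (closure W₂) + 1 with hM
    have hM0 : 0 < M := by
      have : 0 ≤ Cg * μ.real (closure W₂) := mul_nonneg hCg0 measureReal_nonneg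
      linarith
    set η : ℝ := (ε / 4) / M with hη
    have hη0 : 0 < η := div_pos (by linarith) hM0
    have hη1 : η ≤ 1 / M * (ε / 4) := by rw [hη]; ring_nf; exact le_rfl
    have hηM : η * M = ε / 4 := by rw [hη]; field_simp
    -- a good index `i`
    have hevU : ∀ᶠ i in atTop, ∀ y ∈ closure W₂, |u i y - U y| ≤ min η 1 := by
      filter_upwards [(Metric.tendstoUniformlyOn_iff.1 hunif) (min η 1) (lt_min hη0 one_pos)]
        with i hi y hy
      have := hi y hy
      rw [Real.dist_eq, abs_sub_comm] at this
      exact this.le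
    have hevδ : ∀ᶠ i in atTop, δ i * (BS + 1) ≤ ε / 4 := by
      have hlim : Tendsto (fun i ↦ δ i * (BS + 1)) atTop (𝓝 0) := by
        simpa using hδ.mul_const (BS + 1)
      filter_upwards [(tendsto_order.1 hlim).2 (ε / 4) (by linarith)] with i hi
      exact hi.le
    obtain ⟨i, hi₀, hilsc, hiU', hiδ⟩ :=
      ((eventually_ge_atTop N₀).and ((hlsc (by linarith : (0:ℝ) < ε / 4)).and
        (hevU.and hevδ))).exists
    have hiU : ∀ y ∈ closure W₂, |u i y - U y| ≤ η := fun y hy ↦ (hiU' y hy).trans (min_le_left _ _)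
    have hiU1 : ∀ y ∈ closure W₂, |u i y - U y| ≤ 1 := fun y hy ↦ (hiU' y hy).trans (min_le_right _ _)
    have hSΩi : closure W₂ ⊆ Ωs i := (hN₀ i hi₀).1
    have hui : IsLocLipschitzOn h (u i) (Ωs i) := hul i
    -- (1) lower semicontinuity at the index `i`
    have h1 : ∫ x in closure W₂, w x * gradNorm h U x ∂μ ≤
        (∫ x in closure W₂, w x * gradNorm h (u i) x ∂μ) + ε / 4 := by
      have := hilsc
      rwa [hset U, hset (ũ i), hũeq i hi₀] at this
    -- (2) `∫ w|∇uᵢ| ≤ ∫ φ(1 + uᵢ - v)|∇uᵢ| + ∫ φ|uᵢ - U||∇uᵢ|`, then the cutoff inequality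
    have hcS : ContinuousOn (u i) (closure W₂) := (hui.continuousOn h).mono hSΩi
    have hcU : ContinuousOn U (closure W₂) := (hU.continuousOn h).mono hW₂Ω
    have hcv : ContinuousOn v (closure W₂) := (hvlip.continuousOn h).mono hW₂Ω
    have hcφ : ContinuousOn φ (closure W₂) := hφcont.continuousOn
    have hIw : IntegrableOn (fun x ↦ w x * gradNorm h (u i) x) (closure W₂) μ :=
      hui.integrableOn_mul_gradNorm h (hΩo i) hW₂c hSΩi hwcont.continuousOn
    have hI1 : IntegrableOn (fun x ↦ φ x * (1 + u i x - v x) * gradNorm h (u i) x) (closure W₂) μ :=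
      hui.integrableOn_mul_gradNorm h (hΩo i) hW₂c hSΩi
        (hcφ.mul ((continuousOn_const.add hcS).sub hcv))
    have hI2 : IntegrableOn (fun x ↦ φ x * |u i x - U x| * gradNorm h (u i) x) (closure W₂) μ :=
      hui.integrableOn_mul_gradNorm h (hΩo i) hW₂c hSΩi (hcφ.mul (hcS.sub hcU).abs)
    have hI12 : IntegrableOn (fun x ↦ φ x * (1 + u i x - v x) * gradNorm h (u i) x +
        φ x * |u i x - U x| * gradNorm h (u i) x) (closure W₂) μ := hI1.add hI2
    have h2 : ∫ x in closure W₂, w x * gradNorm h (u i) x ∂μ ≤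
        (∫ x in closure W₂, φ x * gradNorm h v x ∂μ) +
        (∫ x in closure W₂, |v x - u i x| * gradNorm h φ x ∂μ) +
        δ i * (μ.real (closure W₂) + ∫ x in closure W₂, |v x - u i x| ∂μ) +
        ∫ x in closure W₂, φ x * |u i x - U x| * gradNorm h (u i) x ∂μ := by
      have hpt : ∀ x, w x * gradNorm h (u i) x ≤ φ x * (1 + u i x - v x) * gradNorm h (u i) x +
          φ x * |u i x - U x| * gradNorm h (u i) x := by
        intro x
        have hg := gradNorm_nonneg h (u i) x
        have hφx := (hφ01 x).1
        have hwx : w x = φ x * (1 + U x - v x) := rfl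
        rw [hwx]
        have key : 0 ≤ φ x * gradNorm h (u i) x * (u i x - U x + |u i x - U x|) :=
          mul_nonneg (mul_nonneg hφx hg) (by linarith [neg_le_abs (u i x - U x)])
        nlinarith [key]
      have hmono := integral_mono hIw hI12 hpt
      rw [integral_add hI1 hI2] at hmono
      linarith [hC1 i hi₀]
    -- (3) `∫ |v - uᵢ||∇φ| ≤ δ ∫ |∇φ|` (`∇φ = 0` where `v ≠ U`, `|U - uᵢ| ≤ δ`)
    have hIb : IntegrableOn (fun x ↦ |v x - u i x| * gradNorm h φ x) (closure W₂) μ :=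
      (isLocLipschitzOn_of_contMDiff h hφs).integrableOn_mul_gradNorm h isOpen_univ hW₂c
        (subset_univ _) (hcv.sub hcS).abs
    have h3 : ∫ x in closure W₂, |v x - u i x| * gradNorm h φ x ∂μ ≤
        η * ∫ x in closure W₂, gradNorm h φ x ∂μ := by
      rw [← integral_const_mul]
      refine setIntegral_mono_on hIb (hIφ.const_mul η) isClosed_closure.measurableSet
        fun x hx ↦ ?_
      by_cases hvU : v x = U x
      · rw [hvU]
        exact mul_le_mul_of_nonneg_right ((abs_sub_comm (U x) (u i x)).le.trans (hiU x hx))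
          (gradNorm_nonneg h φ x)
      · have hxW₁ : x ∈ W₁ := hCW₁ (hvC ⟨hW₂Ω hx, hvU⟩)
        rw [hgradφ x hxW₁, mul_zero, mul_zero]
    -- (4) `∫ φ|uᵢ - U||∇uᵢ| ≤ δ Cg μ(S)`
    have h4 : ∫ x in closure W₂, φ x * |u i x - U x| * gradNorm h (u i) x ∂μ ≤
        η * Cg * μ.real (closure W₂) := by
      have hb := norm_setIntegral_le_of_norm_le_const
        (riemannianVolume_lt_top_of_isCompact_holds h le_rfl hW₂c)
        (f := fun x ↦ φ x * |u i x - U x| * gradNorm h (u i) x) (C := η * Cg) (fun x hx ↦ by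
          rw [Real.norm_eq_abs, abs_mul, abs_mul, abs_abs, abs_of_nonneg (hφ01 x).1,
            abs_of_nonneg (gradNorm_nonneg h _ x)]
          have hg : gradNorm h (u i) x ≤ Cg := by
            have := hgrad i x hx
            rwa [hũeq i hi₀] at this
          calc φ x * |u i x - U x| * gradNorm h (u i) x ≤ 1 * η * Cg :=
                mul_le_mul (mul_le_mul (hφ01 x).2 (hiU x hx) (abs_nonneg _) zero_le_one) hg
                  (gradNorm_nonneg h _ x) (by positivity)
            _ = η * Cg := by ring)
      rw [Real.norm_eq_abs] at hb
      exact (le_abs_self _).trans hb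
    -- (5) the approximation error: `∫_S |v - u i| ≤ ∫_S |v - U| + μ(S)`
    have h5 : δ i * (μ.real (closure W₂) + ∫ x in closure W₂, |v x - u i x| ∂μ) ≤ ε / 4 := by
      have hIvU : IntegrableOn (fun x ↦ |v x - U x|) (closure W₂) μ :=
        (hcv.sub hcU).abs.integrableOn_compact hW₂c
      have hIvi : IntegrableOn (fun x ↦ |v x - u i x|) (closure W₂) μ :=
        (hcv.sub hcS).abs.integrableOn_compact hW₂c
      have hI1' : IntegrableOn (fun x ↦ |v x - U x| + 1) (closure W₂) μ :=
        hIvU.add (integrableOn_const (hW₂c.measure_lt_top (μ := μ)).ne)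
      have hint : ∫ x in closure W₂, |v x - u i x| ∂μ ≤
          (∫ x in closure W₂, |v x - U x| ∂μ) + μ.real (closure W₂) := by
        have hmono : ∫ x in closure W₂, |v x - u i x| ∂μ ≤
            ∫ x in closure W₂, (|v x - U x| + 1) ∂μ := by
          refine setIntegral_mono_on hIvi hI1' isClosed_closure.measurableSet fun x hx ↦ ?_
          calc |v x - u i x| = |(v x - U x) + (U x - u i x)| := by ring_nf
            _ ≤ |v x - U x| + |U x - u i x| := abs_add_le _ _
            _ ≤ |v x - U x| + 1 := by
                have := hiU1 x hx; rw [abs_sub_comm] at this; linarith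
        rw [integral_add hIvU (integrableOn_const (hW₂c.measure_lt_top (μ := μ)).ne),
          setIntegral_const, smul_eq_mul, mul_one] at hmono
        exact hmono
      have hle : μ.real (closure W₂) + ∫ x in closure W₂, |v x - u i x| ∂μ ≤ BS + 1 := by
        rw [hBS]; linarith
      calc δ i * (μ.real (closure W₂) + ∫ x in closure W₂, |v x - u i x| ∂μ)
          ≤ δ i * (BS + 1) := mul_le_mul_of_nonneg_left hle (hδ0 i)
        _ ≤ ε / 4 := hiδ
    -- (6) bookkeeping
    have h6 : η * (∫ x in closure W₂, gradNorm h φ x ∂μ) + η * Cg * μ.real (closure W₂) ≤ ε / 4 := by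
      calc η * (∫ x in closure W₂, gradNorm h φ x ∂μ) + η * Cg * μ.real (closure W₂)
          = η * ((∫ x in closure W₂, gradNorm h φ x ∂μ) + Cg * μ.real (closure W₂)) := by ring
        _ ≤ η * M := mul_le_mul_of_nonneg_left (by rw [hM]; linarith) hη0.le
        _ = ε / 4 := hηM
    linarith [h1, h2, h3, h4, h5, h6]
  -- localisation
  have hvS : {x | x ∈ Ω ∧ v x ≠ U x} ⊆ closure W₂ :=
    hvC.trans (hCW₁.trans (subset_closure.trans (hW₁W₂.trans subset_closure)))
  have hφ1' : ∀ x ∈ Ω, v x ≠ U x → φ x = 1 := fun x hx hne ↦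
    hφ1 (subset_closure (hCW₁ (hvC ⟨hx, hne⟩)))
  exact imcfEnergy_le_of_setIntegral_cutoff_le h hΩ hU hvlip hW₂c hW₂Ω hK hKΩ hvK hvS hφ1'
    hφcont hC5


/-! ### The Compactness Theorem for approximate solutions -/

set_option backward.isDefEq.respectTransparency false in
/-- **Compactness Theorem for approximate weak solutions of inverse mean curvature flow**
(Huisken–Ilmanen, J. Differential Geom. 59 (2001), Thm. 2.1, with vanishing additive errors): *Let `uᵢ` be a sequence of
solutions of (1.5) on open sets `Ωᵢ` in `M` such that `uᵢ → u` locally uniformly, `Ωᵢ → Ω`, and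
for each `K ⊂⊂ Ω`, `sup_K |∇uᵢ| ≤ C(K)` for large `i`. Then `u` is a solution of (1.5) on `Ω`.*
Here the `uᵢ` need only be locally Lipschitz and `δᵢ`-approximately minimising on `Ωᵢ`
(`J_{uᵢ}^K(uᵢ) ≤ J_{uᵢ}^K(w) + δᵢ (μ(K) + ∫_K |w − uᵢ|)`, `δᵢ → 0` — the property of the
solutions of the elliptic regularisation (⋆)_ε, `imcfEnergy_le_add_of_regularised`, so that the
passage `ε → 0` of Thm. 3.1 can be done on `M` without the cylinder `M × ℝ`); otherwise: `X` a Riemannian `3`-manifold, `Ω` and the `Ωᵢ` open, `Ωᵢ → Ω` read as "every compact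
`K ⊆ Ω` lies in `Ωᵢ` for large `i`", and the gradient bounds read as local uniform Lipschitz
bounds for the Riemannian distance (every `x ∈ Ω` has a neighbourhood on which the `uᵢ` are
`C`-Lipschitz for large `i`); the conclusion `IsWeakSolution h u Ω` includes the local Lipschitz
continuity of `u` on `Ω` (`lipschitzOnWith_of_tendsto`). Proof: steps 1 and 2 of loc. cit.
(`imcfEnergy_le_of_tendsto_of_le_add_one`, `isWeakSolution_of_forall_le_add_one`).
[cite: HuiskenIlmanenIMCF2001, Thm. 2.1] -/
theorem isWeakSolution_of_tendstoLocallyUniformlyOn_of_approx {u : ℕ → X → ℝ} {U : X → ℝ}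
    {Ωs : ℕ → Set X} {Ω : Set X} {δ : ℕ → ℝ} (hΩ : IsOpen Ω) (hΩo : ∀ i, IsOpen (Ωs i))
    (hul : ∀ i, IsLocLipschitzOn h (u i) (Ωs i)) (hδ0 : ∀ i, 0 ≤ δ i)
    (hδ : Tendsto δ atTop (𝓝 0))
    (happrox : ∀ i, ∀ w, IsCompetitor h (u i) (Ωs i) w → ∀ K, IsCompact K → K ⊆ Ωs i →
      {x | x ∈ Ωs i ∧ w x ≠ u i x} ⊆ K → imcfEnergy h (u i) K (u i) ≤ imcfEnergy h (u i) K w +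
        δ i * ((riemannianMeasure h).real K + ∫ x in K, |w x - u i x| ∂riemannianMeasure h))
    (hnest : ∀ K, IsCompact K → K ⊆ Ω → ∀ᶠ i in atTop, K ⊆ Ωs i)
    (hconv : TendstoLocallyUniformlyOn u U atTop Ω)
    (hlip : letI : RiemannianBundle (fun x : X ↦ TangentSpace (𝓡 3) x) :=
        ⟨h.toContinuousRiemannianMetric.toRiemannianMetric⟩
      letI : PseudoEMetricSpace X := .ofRiemannianMetric (𝓡 3) X
      ∀ x ∈ Ω, ∃ K : ℝ≥0, ∃ V ∈ 𝓝 x, ∀ᶠ i in atTop, LipschitzOnWith K (u i) V) :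
    IsWeakSolution h U Ω := by
  letI : RiemannianBundle (fun x : X ↦ TangentSpace (𝓡 3) x) :=
    ⟨h.toContinuousRiemannianMetric.toRiemannianMetric⟩
  letI : PseudoEMetricSpace X := .ofRiemannianMetric (𝓡 3) X
  -- the limit is Lipschitz wherever the `uᵢ` are equi-Lipschitz
  have hlip' : ∀ x ∈ Ω, ∃ K : ℝ≥0, ∃ V ∈ 𝓝 x,
      (∀ᶠ i in atTop, LipschitzOnWith K (u i) V) ∧ LipschitzOnWith K U V := by
    intro x hx
    obtain ⟨K, V, hV, hK⟩ := hlip x hx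
    refine ⟨K, V ∩ Ω, inter_mem hV (hΩ.mem_nhds hx), hK.mono fun i hi ↦ hi.mono inter_subset_left,
      lipschitzOnWith_of_tendsto (hK.mono fun i hi ↦ hi.mono inter_subset_left) fun y hy ↦ ?_⟩
    exact hconv.tendsto_at hy.2
  have hU : IsLocLipschitzOn h U Ω := isLocLipschitzOn_of_forall_exists_nhds h fun x hx ↦ by
    obtain ⟨K, V, hV, -, hK⟩ := hlip' x hx
    exact ⟨K, V, hV, hK⟩
  -- step 1 and step 2
  exact isWeakSolution_of_forall_le_add_one h hΩ hU fun v hv hv1 K hK hKΩ hvK ↦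
    imcfEnergy_le_of_tendsto_of_approx_of_le_add_one h hΩ hΩo hul hδ0 hδ happrox hnest hconv hlip'
      hU hv hv1 hK hKΩ hvK


end Literature.Geometry.Lorentzian

end
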